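import Literature.MathematicalPhysics.QuantumFieldTheory.Balaban1983to89.T4IndicatorShell
import Summits.QuantumFields.YangMills.Theorems.BalabanUVNodesN21GappedTopCut13CoPH

/-!
# N21 (NE7c) · THE CONSUMER's JUNCTION FOR THE GAPPED TOP CUT, GENERIC HALF: design (i)'s common-refinement shell pieces are dominated by the TWO-SIDED GAPPED
# shells under `Δ`-closeness of the two runs' tested variables, as soon as the collar `(θlo, θhi)` around the common selected letter `θ` clears `Δ` on both sides

Track A of `YM-PLAN.md` (cell `pub-ymgap`, HUMAN RULING D-0062 ∕ D-0149 width seats), node **N21** (NE7c, the single-run shell-weight bound; NOT PRINTED in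
[Bałaban 1983–89]); WIDTH SEAT `pub-ymgap-dag-n21-w2` (gen 3).  THEOREMS ONLY: 0 `def`, 0 `sorry`; COUNT-NEUTRAL; `--kind proof --supports stmt-QuantumFields-20544 --as helper`
(K3⁷ `SpineGivenEndpointR13SepCoPH`).  Imports pub-balaban's `T4IndicatorShell` (`smallInd`, `largeInd`, `shellBelow`, `shellAbove`, `shellPiece`, `prod_eq_core_add_sum_shell`,
`ShellWeightBound`) and dag-n21-d's `…N21GappedTopCut13CoPH` (p618614 ✓: `eq_zero_or_one_of_mul_self`; → definition lane `…Defs` p617809 ✓: `aGapAt`, `aGapAt_self`, `aGapAt_of_subset`;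
def-T FILE 19 `Node00/StepWeightsAtThresholds`: `aWeightAt`, `chiFactorAt`, `chiFactorAt_mul_self ∕ _nonneg ∕ _le_one ∕ _mono`).  No Theses import; restates nothing; cites by name.

WHY (dag-n21-d g11 `ROAD-S.md` §2 ∕ header of `…N21GappedTopCut13CoPHDefs` p617809: «the common-refinement inequality «design (i) shell ≤ gapped shell» needs the two-run site
identification and N16's sup-closeness and is the CONSUMER's (N19′ ∕ U5), NOT typed here»).  `T4IndicatorShell`'s design (i) (the cell's decision, `t4/T4-EST-U5bE2.md`) refines run A's
indicator product `∏ᵢ pᵢ` against run B's `∏ᵢ qᵢ` at the COMMON driving field into the core `∏ᵢ pᵢqᵢ` and ONE shell piece per slot (`prod_eq_core_add_sum_shell`), the shell pieces going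
to the bad class.  dag-n21-d's GAPPED top cut re-letters run A's own top-step factors — small-field factors at the LOWER letter `θlo`, large-field factors at the UPPER letter `θhi`, the
collar `(θlo, θhi)` OPEN around the selected letter `θ` — and bounds the two-sided shell `term − gapped core` (M1)-FREE by pigeonhole over a geometric grid of letters (p619723
`exists_common_depth_topGapShell_le`).  THIS FILE joins the two: if the runs' tested variables are `Δ`-close slot by slot and the collar clears `Δ` (`θlo + Δ ≤ θ`, `θ + Δ ≤ θhi`), then
slot by slot run A's GAPPED factor lies below the common-refinement factor `pᵢqᵢ` (§1; §1b in the letter-indexed `{0,1}` form with closeness as the X-15 device), hence the gapped core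
lies below the common-refinement core and design (i)'s total shell part `Σᵢ shellPiece = ∏p − ∏pq` of a term is at most its gapped shell `∏p − ∏g` (§2 ∕ §2b; run B likewise against ITS
OWN gapped factors; def-T's `a|(P)` shape; §2c LITERALLY at def-T's `aWeightAt` and dag-n21-d's `aGapAt`); and a `ShellWeightBound` for the gapped shells passes to any termwise smaller
nonnegative shell family (§3).  NOT here (not asserted): the closeness input itself (N16's two-run closeness at the indicator's scale, NE3 species, NOT PRINTED), the two-run site
identification `ι` (the consumer puts it inside `χB` ∕ the slot index), the core sandwich on identical indicator sets (NE7 proper), any lettered READING (dag-n21-d's `crGap₁₃VAt`), and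
the DIALS `(n_K, ρ_K)` (this seat's companion `…N21GappedTopCutDials`).

WHAT IS PROVED ([folklore] indicator and finite-product algebra over `ℝ`).
* §1 slots: `smallInd_mono` · ★ `smallInd_gap_le_mul` (`χ_{θlo}(u^A) ≤ χ_θ(u^A)·χ_θ(u^B)`) · ★ `largeInd_gap_le_mul` (`ζ_{θhi}(u^A) ≤ ζ_θ(u^A)·ζ_θ(u^B)`) · run-B twins `…'` ·
  `smallInd_sub_smallInd_eq_shellBelow` ∕ `largeInd_sub_largeInd_eq_shellAbove` (the gapped slot deficit IS the one-sided collar indicator) · `smallInd_mul_one_sub_le_sub_gap` ∕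
  `largeInd_mul_one_sub_le_sub_gap` (design (i)'s mismatch factor ≤ the gapped deficit of the slot).
* §1b LETTER-INDEXED `{0,1}` FAMILIES (def-T's `chiFactorAt` shape: a factor read as a function of its LETTER, closeness as the X-15 monotone DEVICE `χ^A_{θ′} ≤ χ^B_{θ′+Δ}`,
  `χ^B_{θ′} ≤ χ^A_{θ′+Δ}` — no statistic named): ★ `ind_gap_le_mul_of_device` (`χ^A_{θlo} ≤ χ^A_θ χ^B_θ`) · ★ `one_sub_ind_gap_le_mul_of_device` (`1 − χ^A_{θhi} ≤ (1 − χ^A_θ)(1 − χ^B_θ)`).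
* §2 products: `prod_gap_le_prod_mul` · ★★ `sum_shellPiece_le_prod_sub_prod_gap` (`Σ_{i<n} shellPiece p q n i ≤ ∏ p − ∏ g` whenever `0 ≤ g ≤ p·q` slotwise) · `…_mul_le` ·
  ★★ `sum_shellPiece_le_term_sub_gappedCore` (the MIXED-KIND instance, large-field slots `i ∈ P`, small-field slots `i ∉ P`) + run-B twin `…'` · Finset form
  `prod_gap_sdiff_mul_prod_gap_le_core` ∕ `core_sdiff_mul_le_term` ∕ `term_sub_core_le_term_sub_gap`.
* §2b letter-indexed Finset form: ★★ `prod_gapFamily_le_core_of_device` ∕ `coreFamily_le_term` ∕ `term_sub_core_le_term_sub_gapFamily_of_device` (families `χA χB : ι → ℝ → ℝ`,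
  idempotent, in `[0,1]`, monotone in the letter, two devices).
* §2c ★★★ LITERAL AT def-T's (3.2) WEIGHT: `aWeightAt_sub_core_le_aWeightAt_sub_aGapAt_of_device` — for run A's top field `V′`, a label `P ⊆ cubes32 s`, and ANY run-B factor family
  `χB : Iχ → ℝ → ℝ` (read through the consumer's site identification) in `[0,1]`, monotone in the letter, with the two devices against `chiFactorAt … c V′`:
  `a|_θ(P)(V′) − core ≤ a|_θ(P)(V′) − aGapAt θlo θhi s P V′` (`θlo + Δ ≤ θ ≤ θhi − Δ`); + `aGapAt_le_core_of_device`, `core_le_aWeightAt`.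
* §3 `shellWeightBound_of_shell_le` (`ShellWeightBound … shA shB Wsh`, `0 ≤ shA′ ≤ shA`, `0 ≤ shB′ ≤ shB` termwise ⇒ `ShellWeightBound … shA′ shB′ Wsh`).

HONEST FRAMING.  Bookkeeping; nothing of Bałaban's asserted or used; the two-run comparison is the cell's scheme, not print ([III] constructs ONE run); NE7c NOT PRINTED ∕ NOT proved
at print's fixed thresholds ((M1) stands there); the (M1)-free gapped bound holds at a SELECTED RELATIVE letter only (dag-n21-d, [LF-I] p.181's «by a factor»); **N21 NOT discharged**;
K3⁷ NOT claimed; counts UNMOVED (typed 28∕28 · discharged 5∕27); never a count claim.  One finite four-torus programme at fixed `ε` — NOT ℝ⁴, NOT infinite volume, NOT OS, NOT a mass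
gap, NOT the Clay problem.  No decl below carries a cite tag.
-/

open Finset

namespace Summit.QuantumFields.YangMills.Theorems.N21GappedCollarDesignI

open Literature.MathematicalPhysics.QuantumFieldTheory.Balaban1983to89.T4IndicatorShell
open Summit.QuantumFields.YangMills.Theorems.N21ShellSplitOfRecord13CoPH (eq_zero_or_one_of_mul_self)

/-! ## §1 One slot: the gapped factor lies below the common-refinement factor when the collar clears the closeness -/

section Slot

/-- Raising a small-field threshold enlarges the event: `χ_θ(u) ≤ χ_{θ'}(u)` for `θ ≤ θ'`. [folklore] -/
theorem smallInd_mono {u θ θ' : ℝ} (h : θ ≤ θ') : smallInd u θ ≤ smallInd u θ' := by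
  unfold smallInd
  by_cases h1 : u < θ
  · have h2 : u < θ' := lt_of_lt_of_le h1 h
    simp [h1, h2]
  · simp only [h1, if_false]
    split_ifs <;> norm_num

/-- ★ **GAPPED SMALL-FIELD FACTOR ≤ COMMON-REFINEMENT FACTOR.**  If the two runs' tested variables of a slot are `Δ`-close and the LOWER letter clears the closeness below the
common letter (`θlo + Δ ≤ θ`), then `χ_{θlo}(u^A) ≤ χ_θ(u^A)·χ_θ(u^B)`: run A small at the lowered letter forces BOTH runs small at `θ`. [folklore] -/
theorem smallInd_gap_le_mul {uA uB θlo θ Δ : ℝ} (hclose : |uA - uB| ≤ Δ) (hlo : θlo + Δ ≤ θ) :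
    smallInd uA θlo ≤ smallInd uA θ * smallInd uB θ := by
  have h' := abs_sub_le_iff.1 hclose
  unfold smallInd
  by_cases hA : uA < θlo
  · have hA' : uA < θ := by linarith [h'.1, h'.2, abs_nonneg (uA - uB)]
    have hB' : uB < θ := by linarith [h'.2]
    simp [hA, hA', hB']
  · simp only [hA, if_false]
    exact mul_nonneg (by split_ifs <;> norm_num) (by split_ifs <;> norm_num)

/-- ★ **GAPPED LARGE-FIELD FACTOR ≤ COMMON-REFINEMENT FACTOR.**  If `|u^A − u^B| ≤ Δ` and the UPPER letter clears the closeness above the common letter (`θ + Δ ≤ θhi`), then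
`ζ_{θhi}(u^A) ≤ ζ_θ(u^A)·ζ_θ(u^B)`: run A large at the raised letter forces BOTH runs large at `θ`. [folklore] -/
theorem largeInd_gap_le_mul {uA uB θ θhi Δ : ℝ} (hclose : |uA - uB| ≤ Δ) (hhi : θ + Δ ≤ θhi) :
    largeInd uA θhi ≤ largeInd uA θ * largeInd uB θ := by
  have h' := abs_sub_le_iff.1 hclose
  unfold largeInd
  by_cases hA : θhi ≤ uA
  · have hA' : θ ≤ uA := by linarith [h'.1, h'.2, abs_nonneg (uA - uB)]
    have hB' : θ ≤ uB := by linarith [h'.1]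
    simp [hA, hA', hB']
  · simp only [hA, if_false]
    exact mul_nonneg (by split_ifs <;> norm_num) (by split_ifs <;> norm_num)

/-- Run B's gapped small-field factor against the SAME common-refinement factor (roles swapped by `|u^B − u^A| ≤ Δ`). [folklore] -/
theorem smallInd_gap_le_mul' {uA uB θlo θ Δ : ℝ} (hclose : |uA - uB| ≤ Δ) (hlo : θlo + Δ ≤ θ) :
    smallInd uB θlo ≤ smallInd uA θ * smallInd uB θ := by
  rw [mul_comm]
  exact smallInd_gap_le_mul (abs_sub_comm_le hclose) hlo

/-- Run B's gapped large-field factor against the same common-refinement factor. [folklore] -/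
theorem largeInd_gap_le_mul' {uA uB θ θhi Δ : ℝ} (hclose : |uA - uB| ≤ Δ) (hhi : θ + Δ ≤ θhi) :
    largeInd uB θhi ≤ largeInd uA θ * largeInd uB θ := by
  rw [mul_comm]
  exact largeInd_gap_le_mul (abs_sub_comm_le hclose) hhi

/-- **THE GAPPED DEFICIT OF A SMALL-FIELD SLOT IS THE LOWER COLLAR INDICATOR**: `χ_θ(u) − χ_{θlo}(u) = 1[θlo ≤ u < θ]` (`= shellBelow u θ (θ − θlo)`) for `θlo ≤ θ` — the
summand of dag-n21-d's collar count `collarAt` read one-sidedly. [folklore] -/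
theorem smallInd_sub_smallInd_eq_shellBelow {u θlo θ : ℝ} (h : θlo ≤ θ) :
    smallInd u θ - smallInd u θlo = shellBelow u θ (θ - θlo) := by
  have e : θ - (θ - θlo) = θlo := by ring
  unfold smallInd shellBelow
  rw [e]
  by_cases h1 : u < θlo
  · have h2 : u < θ := lt_of_lt_of_le h1 h
    simp [h1, h2, not_le.2 h1]
  · by_cases h2 : u < θ
    · simp [h1, h2, not_lt.1 h1]
    · simp [h1, h2]

/-- **THE GAPPED DEFICIT OF A LARGE-FIELD SLOT IS THE UPPER COLLAR INDICATOR**: `ζ_θ(u) − ζ_{θhi}(u) = 1[θ ≤ u < θhi]` (`= shellAbove u θ (θhi − θ)`) for `θ ≤ θhi`. [folklore] -/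
theorem largeInd_sub_largeInd_eq_shellAbove {u θ θhi : ℝ} (h : θ ≤ θhi) :
    largeInd u θ - largeInd u θhi = shellAbove u θ (θhi - θ) := by
  have e : θ + (θhi - θ) = θhi := by ring
  unfold largeInd shellAbove
  rw [e]
  by_cases h1 : θhi ≤ u
  · have h2 : θ ≤ u := h.trans h1
    simp [h1, h2, not_lt.2 h1]
  · by_cases h2 : θ ≤ u
    · simp [h1, h2, not_le.1 h1]
    · simp [h1, h2]

/-- **DESIGN (i)'s SMALL-FIELD MISMATCH FACTOR ≤ THE GAPPED DEFICIT OF THE SLOT**: `χ_θ(u^A)(1 − χ_θ(u^B)) ≤ χ_θ(u^A) − χ_{θlo}(u^A)` under `Δ`-closeness and `θlo + Δ ≤ θ`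
(`p(1 − q) = p − pq ≤ p − g`). [folklore] -/
theorem smallInd_mul_one_sub_le_sub_gap {uA uB θlo θ Δ : ℝ} (hclose : |uA - uB| ≤ Δ) (hlo : θlo + Δ ≤ θ) :
    smallInd uA θ * (1 - smallInd uB θ) ≤ smallInd uA θ - smallInd uA θlo := by
  have h := smallInd_gap_le_mul (θ := θ) hclose hlo
  rw [mul_sub, mul_one]
  linarith

/-- **DESIGN (i)'s LARGE-FIELD MISMATCH FACTOR ≤ THE GAPPED DEFICIT OF THE SLOT**: `ζ_θ(u^A)(1 − ζ_θ(u^B)) ≤ ζ_θ(u^A) − ζ_{θhi}(u^A)` under `Δ`-closeness and `θ + Δ ≤ θhi`.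
[folklore] -/
theorem largeInd_mul_one_sub_le_sub_gap {uA uB θ θhi Δ : ℝ} (hclose : |uA - uB| ≤ Δ) (hhi : θ + Δ ≤ θhi) :
    largeInd uA θ * (1 - largeInd uB θ) ≤ largeInd uA θ - largeInd uA θhi := by
  have h := largeInd_gap_le_mul (θ := θ) hclose hhi
  rw [mul_sub, mul_one]
  linarith

end Slot

/-! ## §1b Letter-indexed `{0,1}` families with the monotone device (def-T's `chiFactorAt` shape) -/

section Device

/-- ★ **GAPPED SMALL-FIELD FACTOR ≤ COMMON-REFINEMENT FACTOR, LETTER-INDEXED FORM.**  One slot, run A's factor `pA` and run B's factor `pB` as functions of the LETTER (e.g.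
`θ′ ↦ chiFactorAt … θ′ c V′^A` and `θ′ ↦ chiFactorAt … θ′ (ι c) V′^B`): if `pA(θlo) ∈ {0,1}` (idempotent), `pA(θ), pB(θ) ≥ 0`, both are monotone on the letters used, and the X-15 DEVICE
`pA(θlo) ≤ pB(θlo + Δ)` holds (closeness at indicator level), then for `θlo + Δ ≤ θ`: `pA(θlo) ≤ pA(θ)·pB(θ)`. [folklore] -/
theorem ind_gap_le_mul_of_device {pA pB : ℝ → ℝ} {θlo θ Δ : ℝ} (hidem : pA θlo * pA θlo = pA θlo) (hA0 : 0 ≤ pA θ) (hB0 : 0 ≤ pB θ)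
    (hmonoA : pA θlo ≤ pA θ) (hmonoB : pB (θlo + Δ) ≤ pB θ) (hdev : pA θlo ≤ pB (θlo + Δ)) :
    pA θlo ≤ pA θ * pB θ := by
  rcases eq_zero_or_one_of_mul_self hidem with h | h
  · rw [h]; exact mul_nonneg hA0 hB0
  · rw [h] at hmonoA hdev ⊢
    nlinarith [hdev.trans hmonoB]

/-- ★ **GAPPED LARGE-FIELD FACTOR ≤ COMMON-REFINEMENT FACTOR, LETTER-INDEXED FORM.**  With `pA(θhi) ∈ {0,1}`, `pA(θ), pB(θ) ∈ [0,1]`, `pA` monotone on `θ ≤ θ + Δ ≤ θhi` and the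
reverse device `pB(θ) ≤ pA(θ + Δ)`: for `θ + Δ ≤ θhi`, `1 − pA(θhi) ≤ (1 − pA(θ))·(1 − pB(θ))`. [folklore] -/
theorem one_sub_ind_gap_le_mul_of_device {pA pB : ℝ → ℝ} {θ θhi Δ : ℝ} (hidem : pA θhi * pA θhi = pA θhi) (hA0 : 0 ≤ pA θ) (hA1 : pA θ ≤ 1)
    (hB0 : 0 ≤ pB θ) (hB1 : pB θ ≤ 1) (hmonoA : pA θ ≤ pA θhi) (hmonoA' : pA (θ + Δ) ≤ pA θhi) (hdev : pB θ ≤ pA (θ + Δ)) :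
    1 - pA θhi ≤ (1 - pA θ) * (1 - pB θ) := by
  rcases eq_zero_or_one_of_mul_self hidem with h | h
  · rw [h] at hmonoA hmonoA' ⊢
    have hA : pA θ = 0 := le_antisymm hmonoA hA0
    have hB : pB θ = 0 := le_antisymm (hdev.trans hmonoA') hB0
    rw [hA, hB]; norm_num
  · rw [h]
    nlinarith [mul_nonneg (sub_nonneg.2 hA1) (sub_nonneg.2 hB1)]

end Device

/-! ## §2 Products: the gapped core lies below the common-refinement core, so design (i)'s shell part lies below the gapped shell -/

section Product

/-- A slotwise sandwich `0 ≤ g ≤ p·q` multiplies: `∏ g ≤ ∏ (p·q)` over any finite slot set. [folklore] -/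
theorem prod_gap_le_prod_mul {ι : Type*} (s : Finset ι) {p q g : ι → ℝ} (hg0 : ∀ i ∈ s, 0 ≤ g i) (hg : ∀ i ∈ s, g i ≤ p i * q i) :
    ∏ i ∈ s, g i ≤ ∏ i ∈ s, (p i * q i) :=
  prod_le_prod hg0 hg

/-- ★★ **DESIGN (i)'s TOTAL SHELL PART OF A TERM ≤ ITS GAPPED SHELL.**  For slot families `p` (run A), `q` (run B, nonnegative) on `i < n` and a GAPPED family `g` of run A with
`0 ≤ gᵢ ≤ pᵢqᵢ` slotwise: `Σ_{i<n} shellPiece p q n i ≤ ∏_{i<n} pᵢ − ∏_{i<n} gᵢ` (the common-refinement identity `∏p = ∏pq + Σ shellPiece` and `∏g ≤ ∏pq`). [folklore] -/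
theorem sum_shellPiece_le_prod_sub_prod_gap {p q g : ℕ → ℝ} {n : ℕ} (hg0 : ∀ i < n, 0 ≤ g i) (hg : ∀ i < n, g i ≤ p i * q i) :
    ∑ i ∈ range n, shellPiece p q n i ≤ ∏ i ∈ range n, p i - ∏ i ∈ range n, g i := by
  have hid := prod_eq_core_add_sum_shell p q n
  have hcore : ∏ i ∈ range n, g i ≤ ∏ i ∈ range n, (p i * q i) :=
    prod_gap_le_prod_mul (range n) (fun i hi => hg0 i (mem_range.1 hi)) fun i hi => hg i (mem_range.1 hi)
  linarith

/-- The same with a common nonnegative slot density `R` (the dressed slot of the term): `(Σ shellPiece)·R ≤ (∏p − ∏g)·R`. [folklore] -/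
theorem sum_shellPiece_mul_le_prod_sub_prod_gap_mul {p q g : ℕ → ℝ} {n : ℕ} (hg0 : ∀ i < n, 0 ≤ g i) (hg : ∀ i < n, g i ≤ p i * q i) {R : ℝ} (hR : 0 ≤ R) :
    (∑ i ∈ range n, shellPiece p q n i) * R ≤ (∏ i ∈ range n, p i - ∏ i ∈ range n, g i) * R :=
  mul_le_mul_of_nonneg_right (sum_shellPiece_le_prod_sub_prod_gap hg0 hg) hR

/-- ★★ **THE MIXED-KIND INSTANCE (def-T's `a|(P)` shape: large-field factors on the slots `i ∈ P`, small-field factors off `P`).**  Run A's slots read `u^A_i`, run B's `u^B_i`, at the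
common letters `θ i`; the gapped family of run A reads the lowered letters `θlo i` on the small-field slots and the raised letters `θhi i` on the large-field slots.  If every slot
`i < n` is `Δ i`-close and its collar clears `Δ i` on the side it uses, then design (i)'s total shell part of the term is at most its gapped shell:
`Σ_{i<n} shellPiece p q n i ≤ ∏_{i<n} p i − ∏_{i<n} g i`. [folklore] -/
theorem sum_shellPiece_le_term_sub_gappedCore (P : Finset ℕ) (uA uB θlo θ θhi Δ : ℕ → ℝ) {n : ℕ}
    (hclose : ∀ i < n, |uA i - uB i| ≤ Δ i) (hlo : ∀ i < n, i ∉ P → θlo i + Δ i ≤ θ i) (hhi : ∀ i < n, i ∈ P → θ i + Δ i ≤ θhi i) :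
    ∑ i ∈ range n, shellPiece (fun i => if i ∈ P then largeInd (uA i) (θ i) else smallInd (uA i) (θ i))
        (fun i => if i ∈ P then largeInd (uB i) (θ i) else smallInd (uB i) (θ i)) n i ≤
      ∏ i ∈ range n, (if i ∈ P then largeInd (uA i) (θ i) else smallInd (uA i) (θ i)) -
        ∏ i ∈ range n, (if i ∈ P then largeInd (uA i) (θhi i) else smallInd (uA i) (θlo i)) := by
  refine sum_shellPiece_le_prod_sub_prod_gap (fun i _ => ?_) (fun i hi => ?_)
  · by_cases hP : i ∈ P
    · simp only [hP, if_true]; exact largeInd_nonneg _ _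
    · simp only [hP, if_false]; exact smallInd_nonneg _ _
  · by_cases hP : i ∈ P
    · simp only [hP, if_true]; exact largeInd_gap_le_mul (hclose i hi) (hhi i hi hP)
    · simp only [hP, if_false]; exact smallInd_gap_le_mul (hclose i hi) (hlo i hi hP)

/-- Run B's twin: design (i)'s shell part of run B's term against run A (`shellPiece q p`) is at most run B's OWN gapped shell (same letters, same collars). [folklore] -/
theorem sum_shellPiece_le_term_sub_gappedCore' (P : Finset ℕ) (uA uB θlo θ θhi Δ : ℕ → ℝ) {n : ℕ}
    (hclose : ∀ i < n, |uA i - uB i| ≤ Δ i) (hlo : ∀ i < n, i ∉ P → θlo i + Δ i ≤ θ i) (hhi : ∀ i < n, i ∈ P → θ i + Δ i ≤ θhi i) :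
    ∑ i ∈ range n, shellPiece (fun i => if i ∈ P then largeInd (uB i) (θ i) else smallInd (uB i) (θ i))
        (fun i => if i ∈ P then largeInd (uA i) (θ i) else smallInd (uA i) (θ i)) n i ≤
      ∏ i ∈ range n, (if i ∈ P then largeInd (uB i) (θ i) else smallInd (uB i) (θ i)) -
        ∏ i ∈ range n, (if i ∈ P then largeInd (uB i) (θhi i) else smallInd (uB i) (θlo i)) :=
  sum_shellPiece_le_term_sub_gappedCore P uB uA θlo θ θhi Δ (fun i hi => abs_sub_comm_le (hclose i hi)) hlo hhi

/-- **FINSET FORM, def-T's (3.2) SHAPE `χ(S ∖ P)|_{θlo} · χᶜ(P)|_{θhi}`.**  Over any finite label type: the GAPPED (3.2)-shaped weight of run A at one common letter `θ` with collar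
`(θlo, θhi)` clearing `Δ` lies below the common-refinement core `∏_{S∖P} χ_θ(u^A)χ_θ(u^B) · ∏_P ζ_θ(u^A)ζ_θ(u^B)`. [folklore] -/
theorem prod_gap_sdiff_mul_prod_gap_le_core {ι : Type*} [DecidableEq ι] (S P : Finset ι) (uA uB : ι → ℝ) {θlo θ θhi Δ : ℝ}
    (hclose : ∀ c ∈ S ∪ P, |uA c - uB c| ≤ Δ) (hlo : θlo + Δ ≤ θ) (hhi : θ + Δ ≤ θhi) :
    (∏ c ∈ S \ P, smallInd (uA c) θlo) * ∏ c ∈ P, largeInd (uA c) θhi ≤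
      (∏ c ∈ S \ P, (smallInd (uA c) θ * smallInd (uB c) θ)) * ∏ c ∈ P, (largeInd (uA c) θ * largeInd (uB c) θ) := by
  refine mul_le_mul ?_ ?_ (prod_nonneg fun c _ => largeInd_nonneg _ _) (prod_nonneg fun c _ => mul_nonneg (smallInd_nonneg _ _) (smallInd_nonneg _ _))
  · exact prod_le_prod (fun c _ => smallInd_nonneg _ _) fun c hc =>
      smallInd_gap_le_mul (hclose c (mem_union_left _ (mem_sdiff.1 hc).1)) hlo
  · exact prod_le_prod (fun c _ => largeInd_nonneg _ _) fun c hc =>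
      largeInd_gap_le_mul (hclose c (mem_union_right _ hc)) hhi

/-- … and the common-refinement core lies below run A's (3.2)-shaped term `∏_{S∖P} χ_θ(u^A) · ∏_P ζ_θ(u^A)` (factors of run B in `[0,1]`). [folklore] -/
theorem core_sdiff_mul_le_term {ι : Type*} [DecidableEq ι] (S P : Finset ι) (uA uB : ι → ℝ) (θ : ℝ) :
    (∏ c ∈ S \ P, (smallInd (uA c) θ * smallInd (uB c) θ)) * ∏ c ∈ P, (largeInd (uA c) θ * largeInd (uB c) θ) ≤
      (∏ c ∈ S \ P, smallInd (uA c) θ) * ∏ c ∈ P, largeInd (uA c) θ := by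
  refine mul_le_mul ?_ ?_ (prod_nonneg fun c _ => mul_nonneg (largeInd_nonneg _ _) (largeInd_nonneg _ _)) (prod_nonneg fun c _ => smallInd_nonneg _ _)
  · exact prod_le_prod (fun c _ => mul_nonneg (smallInd_nonneg _ _) (smallInd_nonneg _ _)) fun c _ =>
      mul_le_of_le_one_right (smallInd_nonneg _ _) (smallInd_le_one _ _)
  · exact prod_le_prod (fun c _ => mul_nonneg (largeInd_nonneg _ _) (largeInd_nonneg _ _)) fun c _ =>
      mul_le_of_le_one_right (largeInd_nonneg _ _) (largeInd_le_one _ _)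

/-- Hence, in the (3.2) shape, design (i)'s deficit `term − core` of run A is at most its gapped shell `term − gapped`. [folklore] -/
theorem term_sub_core_le_term_sub_gap {ι : Type*} [DecidableEq ι] (S P : Finset ι) (uA uB : ι → ℝ) {θlo θ θhi Δ : ℝ}
    (hclose : ∀ c ∈ S ∪ P, |uA c - uB c| ≤ Δ) (hlo : θlo + Δ ≤ θ) (hhi : θ + Δ ≤ θhi) :
    (∏ c ∈ S \ P, smallInd (uA c) θ) * (∏ c ∈ P, largeInd (uA c) θ) -
        (∏ c ∈ S \ P, (smallInd (uA c) θ * smallInd (uB c) θ)) * ∏ c ∈ P, (largeInd (uA c) θ * largeInd (uB c) θ) ≤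
      (∏ c ∈ S \ P, smallInd (uA c) θ) * (∏ c ∈ P, largeInd (uA c) θ) - (∏ c ∈ S \ P, smallInd (uA c) θlo) * ∏ c ∈ P, largeInd (uA c) θhi := by
  have h := prod_gap_sdiff_mul_prod_gap_le_core S P uA uB hclose hlo hhi
  linarith

end Product

/-! ## §2b Letter-indexed Finset form: the (3.2) shape `∏_{S∖P} χ_{·} · ∏_P (1 − χ_{·})` with two devices -/

section DeviceFamily

variable {ι : Type*} [DecidableEq ι]

/-- ★★ **GAPPED (3.2)-SHAPED WEIGHT ≤ COMMON-REFINEMENT CORE, LETTER-INDEXED FAMILIES.**  Families `χA χB : ι → ℝ → ℝ` (cube ↦ letter ↦ factor) that are idempotent, in `[0,1]` and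
monotone in the letter, with the two X-15 devices `χA c θ′ ≤ χB c (θ′ + Δ)`, `χB c θ′ ≤ χA c (θ′ + Δ)` (the indicator-level form of the two-run `Δ`-closeness, `0 ≤ Δ`, read through
the consumer's site identification inside `χB`): for `θlo + Δ ≤ θ ≤ θhi − Δ`,
`∏_{S∖P} χA_{θlo} · ∏_P (1 − χA_{θhi}) ≤ ∏_{S∖P} (χA_θ χB_θ) · ∏_P ((1 − χA_θ)(1 − χB_θ))`. [folklore] -/
theorem prod_gapFamily_le_core_of_device (S P : Finset ι) (χA χB : ι → ℝ → ℝ) {θlo θ θhi Δ : ℝ}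
    (hidem : ∀ c θ', χA c θ' * χA c θ' = χA c θ') (h0A : ∀ c θ', 0 ≤ χA c θ') (h1A : ∀ c θ', χA c θ' ≤ 1) (h0B : ∀ c θ', 0 ≤ χB c θ') (h1B : ∀ c θ', χB c θ' ≤ 1)
    (hmA : ∀ c, Monotone (χA c)) (hmB : ∀ c, Monotone (χB c)) (hdevAB : ∀ c θ', χA c θ' ≤ χB c (θ' + Δ)) (hdevBA : ∀ c θ', χB c θ' ≤ χA c (θ' + Δ))
    (hΔ : 0 ≤ Δ) (hlo : θlo + Δ ≤ θ) (hhi : θ + Δ ≤ θhi) :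
    (∏ c ∈ S \ P, χA c θlo) * ∏ c ∈ P, (1 - χA c θhi) ≤ (∏ c ∈ S \ P, (χA c θ * χB c θ)) * ∏ c ∈ P, ((1 - χA c θ) * (1 - χB c θ)) := by
  refine mul_le_mul ?_ ?_ (prod_nonneg fun c _ => sub_nonneg.2 (h1A c _)) (prod_nonneg fun c _ => mul_nonneg (h0A c _) (h0B c _))
  · exact prod_le_prod (fun c _ => h0A c _) fun c _ =>
      ind_gap_le_mul_of_device (hidem c θlo) (h0A c θ) (h0B c θ) (hmA c (by linarith)) (hmB c hlo) (hdevAB c θlo)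
  · exact prod_le_prod (fun c _ => sub_nonneg.2 (h1A c _)) fun c _ =>
      one_sub_ind_gap_le_mul_of_device (hidem c θhi) (h0A c θ) (h1A c θ) (h0B c θ) (h1B c θ) (hmA c (by linarith)) (hmA c hhi) (hdevBA c θ)

/-- The letter-indexed common-refinement core lies below run A's (3.2)-shaped term `∏_{S∖P} χA_θ · ∏_P (1 − χA_θ)` (run B's factors in `[0,1]`). [folklore] -/
theorem coreFamily_le_term (S P : Finset ι) (χA χB : ι → ℝ → ℝ) (θ : ℝ)
    (h0A : ∀ c θ', 0 ≤ χA c θ') (h1A : ∀ c θ', χA c θ' ≤ 1) (h0B : ∀ c θ', 0 ≤ χB c θ') (h1B : ∀ c θ', χB c θ' ≤ 1) :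
    (∏ c ∈ S \ P, (χA c θ * χB c θ)) * ∏ c ∈ P, ((1 - χA c θ) * (1 - χB c θ)) ≤ (∏ c ∈ S \ P, χA c θ) * ∏ c ∈ P, (1 - χA c θ) := by
  refine mul_le_mul ?_ ?_ (prod_nonneg fun c _ => mul_nonneg (sub_nonneg.2 (h1A c _)) (sub_nonneg.2 (h1B c _))) (prod_nonneg fun c _ => h0A c _)
  · exact prod_le_prod (fun c _ => mul_nonneg (h0A c _) (h0B c _)) fun c _ => mul_le_of_le_one_right (h0A c _) (h1B c _)
  · exact prod_le_prod (fun c _ => mul_nonneg (sub_nonneg.2 (h1A c _)) (sub_nonneg.2 (h1B c _))) fun c _ =>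
      mul_le_of_le_one_right (sub_nonneg.2 (h1A c _)) (sub_le_self _ (h0B c _))

/-- ★★ Hence design (i)'s deficit `term − core` of run A lies below its GAPPED shell `term − gapped` (letter-indexed families, two devices). [folklore] -/
theorem term_sub_core_le_term_sub_gapFamily_of_device (S P : Finset ι) (χA χB : ι → ℝ → ℝ) {θlo θ θhi Δ : ℝ}
    (hidem : ∀ c θ', χA c θ' * χA c θ' = χA c θ') (h0A : ∀ c θ', 0 ≤ χA c θ') (h1A : ∀ c θ', χA c θ' ≤ 1) (h0B : ∀ c θ', 0 ≤ χB c θ') (h1B : ∀ c θ', χB c θ' ≤ 1)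
    (hmA : ∀ c, Monotone (χA c)) (hmB : ∀ c, Monotone (χB c)) (hdevAB : ∀ c θ', χA c θ' ≤ χB c (θ' + Δ)) (hdevBA : ∀ c θ', χB c θ' ≤ χA c (θ' + Δ))
    (hΔ : 0 ≤ Δ) (hlo : θlo + Δ ≤ θ) (hhi : θ + Δ ≤ θhi) :
    (∏ c ∈ S \ P, χA c θ) * (∏ c ∈ P, (1 - χA c θ)) - (∏ c ∈ S \ P, (χA c θ * χB c θ)) * ∏ c ∈ P, ((1 - χA c θ) * (1 - χB c θ)) ≤
      (∏ c ∈ S \ P, χA c θ) * (∏ c ∈ P, (1 - χA c θ)) - (∏ c ∈ S \ P, χA c θlo) * ∏ c ∈ P, (1 - χA c θhi) := by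
  have h := prod_gapFamily_le_core_of_device S P χA χB hidem h0A h1A h0B h1B hmA hmB hdevAB hdevBA hΔ hlo hhi
  linarith

end DeviceFamily

/-! ## §2c LITERAL AT def-T's (3.2) WEIGHT `aWeightAt` AND dag-n21-d's GAPPED WEIGHT `aGapAt` (run A's side; run B's factors through the consumer's site identification) -/

section AtGapWeight

open Literature.MathematicalPhysics.QuantumFieldTheory.Balaban1983to89
open Literature.MathematicalPhysics.QuantumFieldTheory.Balaban1983to89.T4Continuum
open Literature.MathematicalPhysics.QuantumFieldTheory.Balaban1983to89.Node00
open Summit.QuantumFields.YangMills.Theorems.N21ShellSplitOfRecord13CoPH (aGapAt aGapAt_self aGapAt_of_subset)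

variable (F : T4Family) (N : ℕ) [NeZero N] (ν : Stage7Numerics) (M : ℕ) (p : B12.RunParams) (g : ℕ → ℝ) (k : ℕ)

/-- Unfolding def-T's `a|_θ(P)` on the (3.2) range through dag-n21-d's equal-letter face `aGapAt_self`: `∏_{cubes32 s ∖ P} χf^θ · ∏_P (1 − χf^θ)`. [bookkeeping] -/
theorem aWeightAt_of_subset (θ : ℝ) (s : SeqOfRecord F ν M g p.K k) {Pl : Finset (Iχ F ν p g k)} (hP : Pl ⊆ cubes32 F ν M p g k s)
    (V' : GaugeField (F.P p.K) (k + 1) (SU N)) :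
    aWeightAt F N ν M p g k θ s Pl V' = (∏ c ∈ cubes32 F ν M p g k s \ Pl, chiFactorAt F N ν p g k θ c V') * ∏ c ∈ Pl, (1 - chiFactorAt F N ν p g k θ c V') := by
  rw [← aGapAt_self, aGapAt_of_subset F N ν M p g k θ θ s hP V']

/-- ★★★ **dag-n21-d's GAPPED (3.2) WEIGHT ≤ THE COMMON-REFINEMENT CORE OF def-T's `a|_θ(P)`.**  Run A's top field `V′`, a label `P ⊆ cubes32 s`, a common letter `θ` with collar
`θlo + Δ ≤ θ ≤ θhi − Δ` (`0 ≤ Δ`), and ANY run-B factor family `χB : Iχ → ℝ → ℝ` (run B's (2.17) factors read through the consumer's site identification) in `[0,1]`, monotone in the letter,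
with the two devices against def-T's `chiFactorAt … c V′` (closeness at indicator level; DISPLAYED):
`aGapAt θlo θhi s P V′ ≤ ∏_{cubes32 s ∖ P} (χf^θ_c(V′)·χB c θ) · ∏_P ((1 − χf^θ_c(V′))(1 − χB c θ))` — def-T's `chiFactorAt_mul_self ∕ _nonneg ∕ _le_one ∕ _mono` BY NAME. [bookkeeping] -/
theorem aGapAt_le_core_of_device {θlo θ θhi Δ : ℝ} (s : SeqOfRecord F ν M g p.K k) {Pl : Finset (Iχ F ν p g k)} (hP : Pl ⊆ cubes32 F ν M p g k s)
    (V' : GaugeField (F.P p.K) (k + 1) (SU N)) (χB : Iχ F ν p g k → ℝ → ℝ) (h0B : ∀ c θ', 0 ≤ χB c θ') (h1B : ∀ c θ', χB c θ' ≤ 1) (hmB : ∀ c, Monotone (χB c))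
    (hdevAB : ∀ c θ', chiFactorAt F N ν p g k θ' c V' ≤ χB c (θ' + Δ)) (hdevBA : ∀ c θ', χB c θ' ≤ chiFactorAt F N ν p g k (θ' + Δ) c V')
    (hΔ : 0 ≤ Δ) (hlo : θlo + Δ ≤ θ) (hhi : θ + Δ ≤ θhi) :
    aGapAt F N ν M p g k θlo θhi s Pl V' ≤
      (∏ c ∈ cubes32 F ν M p g k s \ Pl, (chiFactorAt F N ν p g k θ c V' * χB c θ)) * ∏ c ∈ Pl, ((1 - chiFactorAt F N ν p g k θ c V') * (1 - χB c θ)) := by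
  rw [aGapAt_of_subset F N ν M p g k θlo θhi s hP V']
  exact prod_gapFamily_le_core_of_device (cubes32 F ν M p g k s) Pl (fun c θ' => chiFactorAt F N ν p g k θ' c V') χB
    (fun c θ' => chiFactorAt_mul_self F N ν p g k θ' c V') (fun c θ' => chiFactorAt_nonneg F N ν p g k θ' c V') (fun c θ' => chiFactorAt_le_one F N ν p g k θ' c V')
    h0B h1B (fun c _ _ h => chiFactorAt_mono F N ν p g k h c V') hmB hdevAB hdevBA hΔ hlo hhi

/-- The common-refinement core lies below def-T's `a|_θ(P)(V′)` itself. [bookkeeping] -/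
theorem core_le_aWeightAt (θ : ℝ) (s : SeqOfRecord F ν M g p.K k) {Pl : Finset (Iχ F ν p g k)} (hP : Pl ⊆ cubes32 F ν M p g k s)
    (V' : GaugeField (F.P p.K) (k + 1) (SU N)) (χB : Iχ F ν p g k → ℝ → ℝ) (h0B : ∀ c θ', 0 ≤ χB c θ') (h1B : ∀ c θ', χB c θ' ≤ 1) :
    (∏ c ∈ cubes32 F ν M p g k s \ Pl, (chiFactorAt F N ν p g k θ c V' * χB c θ)) * ∏ c ∈ Pl, ((1 - chiFactorAt F N ν p g k θ c V') * (1 - χB c θ)) ≤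
      aWeightAt F N ν M p g k θ s Pl V' := by
  rw [aWeightAt_of_subset F N ν M p g k θ s hP V']
  exact coreFamily_le_term (cubes32 F ν M p g k s) Pl (fun c θ' => chiFactorAt F N ν p g k θ' c V') χB θ
    (fun c θ' => chiFactorAt_nonneg F N ν p g k θ' c V') (fun c θ' => chiFactorAt_le_one F N ν p g k θ' c V') h0B h1B

/-- ★★★ **THE JUNCTION AT THE (3.2) WEIGHT: design (i)'s deficit of `a|_θ(P)(V′)` against run B is at most dag-n21-d's gapped deficit `a|_θ(P)(V′) − aGapAt θlo θhi s P V′`**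
(the factor of their TWO-SIDED collar shell `topGapShellAt θlo θ θhi` at the (3.2) level), under the two devices and a collar clearing `Δ`. [bookkeeping] -/
theorem aWeightAt_sub_core_le_aWeightAt_sub_aGapAt_of_device {θlo θ θhi Δ : ℝ} (s : SeqOfRecord F ν M g p.K k) {Pl : Finset (Iχ F ν p g k)}
    (hP : Pl ⊆ cubes32 F ν M p g k s) (V' : GaugeField (F.P p.K) (k + 1) (SU N)) (χB : Iχ F ν p g k → ℝ → ℝ)
    (h0B : ∀ c θ', 0 ≤ χB c θ') (h1B : ∀ c θ', χB c θ' ≤ 1) (hmB : ∀ c, Monotone (χB c))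
    (hdevAB : ∀ c θ', chiFactorAt F N ν p g k θ' c V' ≤ χB c (θ' + Δ)) (hdevBA : ∀ c θ', χB c θ' ≤ chiFactorAt F N ν p g k (θ' + Δ) c V')
    (hΔ : 0 ≤ Δ) (hlo : θlo + Δ ≤ θ) (hhi : θ + Δ ≤ θhi) :
    aWeightAt F N ν M p g k θ s Pl V' -
        (∏ c ∈ cubes32 F ν M p g k s \ Pl, (chiFactorAt F N ν p g k θ c V' * χB c θ)) * ∏ c ∈ Pl, ((1 - chiFactorAt F N ν p g k θ c V') * (1 - χB c θ)) ≤
      aWeightAt F N ν M p g k θ s Pl V' - aGapAt F N ν M p g k θlo θhi s Pl V' := by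
  have h := aGapAt_le_core_of_device F N ν M p g k s hP V' χB h0B h1B hmB hdevAB hdevBA hΔ hlo hhi
  linarith

end AtGapWeight

/-! ## §3 A `ShellWeightBound` for the gapped shells is inherited by any termwise smaller nonnegative shell family -/

section Transfer

/-- **`ShellWeightBound` IS MONOTONE IN THE SHELL PARTS.**  If the two runs' term families `A`, `B` carry shell parts `shA`, `shB` with `T4IndicatorShell.ShellWeightBound … Wsh` (e.g.
dag-n21-d's two-sided GAPPED shells) and `shA′`, `shB′` are termwise nonnegative and no larger (e.g. design (i)'s common-refinement shell parts, §2), then `ShellWeightBound … shA′ shB′ Wsh`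
with the SAME weights. [folklore] -/
theorem shellWeightBound_of_shell_le {ι : Type*} {l₀ : ℝ} {T : ℕ → Finset ι} {A B shA shB shA' shB' : ℕ → ℝ → ι → ℝ} {Wsh : ℕ → ℝ}
    (h : ShellWeightBound l₀ T A B shA shB Wsh)
    (hA0 : ∀ K t, |t| ≤ l₀ → ∀ τ ∈ T K, 0 ≤ shA' K t τ) (hA : ∀ K t, |t| ≤ l₀ → ∀ τ ∈ T K, shA' K t τ ≤ shA K t τ)
    (hB0 : ∀ K t, |t| ≤ l₀ → ∀ τ ∈ T K, 0 ≤ shB' K t τ) (hB : ∀ K t, |t| ≤ l₀ → ∀ τ ∈ T K, shB' K t τ ≤ shB K t τ) :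
    ShellWeightBound l₀ T A B shA' shB' Wsh where
  nonneg := h.nonneg
  summable := h.summable
  sh_nonneg_left := hA0
  sh_le_left K t ht τ hτ := (hA K t ht τ hτ).trans (h.sh_le_left K t ht τ hτ)
  sh_nonneg_right := hB0
  sh_le_right K t ht τ hτ := (hB K t ht τ hτ).trans (h.sh_le_right K t ht τ hτ)
  left K t ht := (sum_le_sum fun τ hτ => hA K t ht τ hτ).trans (h.left K t ht)
  right K t ht := (sum_le_sum fun τ hτ => hB K t ht τ hτ).trans (h.right K t ht)

end Transfer

end Summit.QuantumFields.YangMills.Theorems.N21GappedCollarDesignI
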